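import Summits.QuantumFields.YangMills.Theorems.BalabanUVNodesN20BlockCaricatureExactCriterion

/-!
# BalabanUVNodes ∕ N20·N19′·N21 — THE LARGE-FIELD COUNT IS SUFFICIENT (FILE F of the caricature series): the ℓ¹ distance of the two runs' CONFIGURATION laws equals the ℓ¹
# distance of their large-field COUNT laws `Bin(n_K, p_K)` vs `Bin(n_K, q_K)`, so FILE D's exact criterion reads verbatim in CRIT-1's «block-COUNT law» letters:
# `HybridNE7` (hence stub 2's face triple) for some dials ⟺ `Σ_K Σ_{k ≤ n_K} C(n_K,k)·|q_K^k(1−q_K)^{n_K−k} − p_K^k(1−p_K)^{n_K−k}| < ∞`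

Cell `pub-ymgap` (HUMAN RULING D-0062 Track A; work-bound push D-0149, director-ym №197), width seat `pub-ymgap-dag-n20-w1` (gen 5) on node N20 = NE7b; key item K3⁷
`SpineGivenEndpointR13SepCoPH` = stmt-QuantumFields-20544 (`--kind proof --supports 20544 --as helper`); COUNT-NEUTRAL.  Bus: CLAIM-13 ∕ INTENT-17 (INBOX l.32107).
THEOREMS ONLY: no `def`, no `instance`, no `notation`, no `sorry`; imports this seat's FILE D `…N20BlockCaricatureExactCriterion` (p616042) only; Mathlib's
`Finset.sum_powerset_apply_card` (grouping the powerset by cardinality) BY NAME.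

WHY.  CRIT-1's triage of `window-key-core` ed. 2 (Rec. (b)) and the card's «Cheapest falsifier» speak of «the level-1 large-field block-COUNT laws under `weightA₁₃` vs `weightB₁₃`»;
FILES A–E typed the caricature at the CONFIGURATION level (classes `S ⊆ range n_K`, product Bernoulli weights `p^{#S}(1−p)^{n−#S}`) — the natural carrier for the dials (a bad class
or a shell is a set of configurations).  The two descriptions carry the SAME two-run discrepancy: the likelihood ratio `B_S∕A_S = (q∕p)^{#S}((1−q)∕(1−p))^{n−#S}` depends on `S` only
through the count `#S`, so the count is a SUFFICIENT statistic and the ℓ¹ (= 2·TV) distances agree (§1 ★ `l1_config_eq_l1_count`, one application of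
`Finset.sum_powerset_apply_card`).  Hence FILE D's exact criterion in count letters (§2 ★★ `exists_hybridNE7_caricature_iff_summable_l1_count`, face-triple edition
`faces_caricature_iff_summable_l1_count`), and dag-n19-w2 g5's count-key files (p612301 ∕ p615382) and this series address one object.
* §1 [folklore] ★ `l1_config_eq_l1_count` (`Σ_{S ⊆ range n} |B_S − A_S| = Σ_{k ≤ n} C(n,k)·|q^k(1−q)^{n−k} − p^k(1−p)^{n−k}|`) · `sum_count_eq_one` (the binomial count law has total `1`).
* §2 [folklore ∕ bookkeeping] ★★ `exists_hybridNE7_caricature_iff_summable_l1_count` · ★ `faces_caricature_iff_summable_l1_count`.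

HONEST FRAMING.  [folklore] finite sums on a CARICATURE (independent blocks, product Bernoulli class weights — the card's simplification); nothing read at the record
(`classSet₁₃ ∕ weightA₁₃ ∕ weightB₁₃` untouched; (LS)∕(XG′)∕(SAT′) at the record UNDECIDED); proves NO estimate of Bałaban's; refutes NO registered stub; nothing of Bałaban's
asserted or instantiated.  NE7 ∕ NE7b ∕ NE7c NOT PRINTED for `d = 4`, NOT proved; N19 ∕ N20 ∕ N21 NOT discharged; K3⁷ OPEN, skeleton v5 941dddb108cbaacf STANDS; counts unmoved (typed
28∕28 · discharged 5∕27); no count claim.  One finite `𝕋⁴_{L^K}` programme at fixed `ε = L^{−K}`, Bałaban AS PRINTED; the YM mass gap (Clay) is NOT proved by any of this — R4 closes the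
conditional finite-𝕋⁴ rung `BalabanLadder.UV` only; NOT ℝ⁴, NOT OS.  Sources (bookkeeping only): [Balaban1988Convergent] (1.1) p.244, (2.18) p.257.  No decl carries a cite tag.
-/

set_option autoImplicit false

noncomputable section

open Finset
open Literature.MathematicalPhysics.QuantumFieldTheory.Balaban1983to89
open Literature.MathematicalPhysics.QuantumFieldTheory.Balaban1983to89.T4WeightBudget
open Literature.MathematicalPhysics.QuantumFieldTheory.Balaban1983to89.T4IndicatorShell
open Literature.MathematicalPhysics.QuantumFieldTheory.Balaban1983to89.T4MatchingAssembly (HybridNE7)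
open Summit.QuantumFields.BalabanUV.T4Continuum.Spine.NE7
open Summit.QuantumFields.YangMills.BalabanUVNodes.N20BlockCaricatureExactCriterion (exists_hybridNE7_caricature_iff_summable_l1 faces_caricature_iff_summable_l1)

namespace Summit.QuantumFields.YangMills.BalabanUVNodes.N20BlockCaricatureCountStatistic

/-! ## §1 The count is sufficient: configuration ℓ¹ = count ℓ¹ -/

/-- ★ **CONFIGURATION ℓ¹ = COUNT ℓ¹** [folklore]: `Σ_{S ⊆ range n} |q^{#S}(1−q)^{n−#S} − p^{#S}(1−p)^{n−#S}| = Σ_{k ≤ n} C(n,k)·|q^k(1−q)^{n−k} − p^k(1−p)^{n−k}|` — the ℓ¹ distance of the two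
runs' configuration laws is the ℓ¹ distance of the binomial count laws `Bin(n,p)`, `Bin(n,q)` (the summand depends on `S` through `#S` only; `Finset.sum_powerset_apply_card`). -/
theorem l1_config_eq_l1_count (p q : ℝ) (n : ℕ) :
    ∑ S ∈ (Finset.range n).powerset, |q ^ S.card * (1 - q) ^ (n - S.card) - p ^ S.card * (1 - p) ^ (n - S.card)| =
      ∑ k ∈ Finset.range (n + 1), (n.choose k : ℝ) * |q ^ k * (1 - q) ^ (n - k) - p ^ k * (1 - p) ^ (n - k)| := by
  have h := Finset.sum_powerset_apply_card (fun k => |q ^ k * (1 - q) ^ (n - k) - p ^ k * (1 - p) ^ (n - k)|) (x := Finset.range n)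
  rw [Finset.card_range] at h
  rw [h]
  exact Finset.sum_congr rfl fun k _ => by rw [nsmul_eq_mul]

/-- The binomial count law has total `1`: `Σ_{k ≤ n} C(n,k) p^k (1−p)^{n−k} = 1` (the configuration total of FILE A grouped by count). [folklore] -/
theorem sum_count_eq_one (p : ℝ) (n : ℕ) :
    ∑ k ∈ Finset.range (n + 1), (n.choose k : ℝ) * (p ^ k * (1 - p) ^ (n - k)) = 1 := by
  have h := Finset.sum_powerset_apply_card (fun k => p ^ k * (1 - p) ^ (n - k)) (x := Finset.range n)
  rw [Finset.card_range] at h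
  calc ∑ k ∈ Finset.range (n + 1), (n.choose k : ℝ) * (p ^ k * (1 - p) ^ (n - k))
      = ∑ k ∈ Finset.range (n + 1), n.choose k • (p ^ k * (1 - p) ^ (n - k)) := Finset.sum_congr rfl fun k _ => by rw [nsmul_eq_mul]
    _ = ∑ S ∈ (Finset.range n).powerset, p ^ S.card * (1 - p) ^ (n - S.card) := h.symm
    _ = 1 := N20BlockCaricatureAffinity.sum_config_eq_one p n

/-! ## §2 FILE D's exact criterion in count letters -/

section AlongK

variable (n : ℕ → ℕ) (p q : ℕ → ℝ)

/-- ★★ **THE EXACT CRITERION IN COUNT LETTERS** [folklore ∕ bookkeeping]: for `p_K ∈ (0, 1)`, `q_K ∈ [0, 1]`, any `vol`, `l₀ ≥ 0`: SOME `(Bad, W, shA, shB, Wsh, δ)` give node U5's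
bundled binder list `HybridNE7` on the caricature carriers IFF the ℓ¹ distances of the binomial COUNT laws are summable,
`Σ_K Σ_{k ≤ n_K} C(n_K,k)·|q_K^k(1−q_K)^{n_K−k} − p_K^k(1−p_K)^{n_K−k}| < ∞` (FILE D `exists_hybridNE7_caricature_iff_summable_l1` ∘ §1). -/
theorem exists_hybridNE7_caricature_iff_summable_l1_count (hp : ∀ K, 0 < p K ∧ p K < 1) (hq : ∀ K, 0 ≤ q K ∧ q K ≤ 1)
    {l₀ : ℝ} (hl₀ : 0 ≤ l₀) (vol : ℝ) :
    (∃ (Bad : ℕ → ℝ → Finset (Finset ℕ)) (W : ℕ → ℝ) (shA shB : ℕ → ℝ → Finset ℕ → ℝ) (Wsh δ : ℕ → ℝ),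
      HybridNE7 l₀ vol (fun K => (Finset.range (n K)).powerset) (fun K _ S => p K ^ S.card * (1 - p K) ^ (n K - S.card))
        (fun K _ S => q K ^ S.card * (1 - q K) ^ (n K - S.card)) Bad W shA shB Wsh δ) ↔
    Summable fun K => ∑ k ∈ Finset.range (n K + 1), ((n K).choose k : ℝ) * |q K ^ k * (1 - q K) ^ (n K - k) - p K ^ k * (1 - p K) ^ (n K - k)| := by
  rw [exists_hybridNE7_caricature_iff_summable_l1 n p q hp hq hl₀ vol]
  exact summable_congr fun K => l1_config_eq_l1_count (p K) (q K) (n K)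

/-- ★ **THE FACE-TRIPLE EDITION IN COUNT LETTERS** [folklore ∕ bookkeeping]: the same for K3⁷ v5 stub 2's own conjunct shape `RelWeightBound ∧ ShellWeightBound ∧ (Core ∧ Summable δ)`. -/
theorem faces_caricature_iff_summable_l1_count (hp : ∀ K, 0 < p K ∧ p K < 1) (hq : ∀ K, 0 ≤ q K ∧ q K ≤ 1)
    {l₀ : ℝ} (hl₀ : 0 ≤ l₀) (vol : ℝ) :
    (∃ (Bad : ℕ → ℝ → Finset (Finset ℕ)) (W : ℕ → ℝ) (shA shB : ℕ → ℝ → Finset ℕ → ℝ) (Wsh δ : ℕ → ℝ),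
      RelWeightBound l₀ (fun K => (Finset.range (n K)).powerset) (fun K _ S => p K ^ S.card * (1 - p K) ^ (n K - S.card))
        (fun K _ S => q K ^ S.card * (1 - q K) ^ (n K - S.card)) Bad W ∧
      ShellWeightBound l₀ (fun K => (Finset.range (n K)).powerset) (fun K _ S => p K ^ S.card * (1 - p K) ^ (n K - S.card))
        (fun K _ S => q K ^ S.card * (1 - q K) ^ (n K - S.card)) shA shB Wsh ∧
      (Core l₀ vol (fun K => (Finset.range (n K)).powerset) Bad (fun K t S => p K ^ S.card * (1 - p K) ^ (n K - S.card) - shA K t S)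
        (fun K t S => q K ^ S.card * (1 - q K) ^ (n K - S.card) - shB K t S) δ ∧ Summable δ)) ↔
    Summable fun K => ∑ k ∈ Finset.range (n K + 1), ((n K).choose k : ℝ) * |q K ^ k * (1 - q K) ^ (n K - k) - p K ^ k * (1 - p K) ^ (n K - k)| := by
  rw [faces_caricature_iff_summable_l1 n p q hp hq hl₀ vol]
  exact summable_congr fun K => l1_config_eq_l1_count (p K) (q K) (n K)

end AlongK

end Summit.QuantumFields.YangMills.BalabanUVNodes.N20BlockCaricatureCountStatistic

end
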